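import Mathlib
import HarnessLib
import Summits.ValiantsHypothesis.ValiantsHypothesis.Theorems.MonotoneRestorationMonotoneRestorationQPLinearWidthCFIHomMonotone

/-!
# Route MonotoneRestoration, crux `MonotoneRestorationQP` (stmt-15886), line `linear_width` —
# ABSORBING EXTENSIONS OF THE CFI PAIR: monotonicity and retract-strictness survive any common, shadow-invariant extension
# of the two hosts (apices, absorbers, gadgets)

Helper file (`--supports stmt-ValiantsHypothesis-15886`), def-free.  Step (P4) of the g13 census on top of `CFIHomMonotone`
(p841399): there the hosts are the bare CFI graphs `CFI(G,T) ⊆ CFI(G,∅)`-pair and strictness needs the pattern `F` to RETRACT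
onto `G₂`, which a general pattern containing `G₂` does not (the rest of `F` has nowhere to go in a bounded-degree host).  The
remedy is to enlarge BOTH hosts by the same absorbing gadget (e.g. two adjacent apices joined to the two colour classes), attached
in a way that only sees the SHADOW of a CFI vertex in `G₂`.  This file proves that the `𝔽₂`-difference argument is blind to such
extensions:

* `exists_injective_shadowPreserving_ext` — for hosts `X₀, X₁` on `CFIVertex G ⊕ A` whose CFI parts are (contained in)
  `CFI(G,∅)` resp. `CFI(G,T)`, whose `A`-parts satisfy `X₁ ≤ X₀`, and whose cross edges in `X₁` from a CFI vertex `x` to a gadget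
  vertex `a` imply the cross edges in `X₀` from EVERY `x'` with the same shadow to `a`: an injection `Hom(F,X₁) ↪ Hom(F,X₀)`
  preserving shadows in `G₂ ⊕ A` (difference on the CFI part, identity on the gadget part);
* `card_hom_ext_le` — **MONOTONICITY for absorbing extensions**: `hom(F, X₁) ≤ hom(F, X₀)` for every finite `F`;
* `card_hom_ext_lt_of_retract` — **STRICTNESS**: if moreover `F` retracts onto a base graph `B` on `(V(G₂)) ⊕ A` over which the
  zero section `zeroLift ⊕ id` is a homomorphism into `X₀` (CFI part of `B` inside `G₂`, gadget and cross edges of `B` realised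
  in `X₀` at the zero section), through homomorphisms `ι : G₂ → F`, `ρ : F → B` with `ρ ∘ ι = inl`, and `T = {e}` for an edge
  `e`, then `hom(F, X₁) < hom(F, X₀)`.

With `A = ∅`-like trivial gadgets this is `CFIHomMonotone` again; with two apices joined to the colour classes of a bipartite
`G₂` every bipartite `F` containing an INDUCED copy of `G₂` retracts onto `B = G₂ + apices`, so only the `C^k`-equivalence of the
apexed pair ((P3), a colour-preserving Duplicator) stands between this and unconditional linear-size witnesses for all sparse
wide patterns.  Honest label: no stub closed; θ₁, the cruxes and VP ≠ VNP NOT moved.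
[cite: ChenFlumLiu2025, Lemma 12.5, Thm 12.2; Roberson2022, Thm 3.6]
-/

set_option linter.dupNamespace false

noncomputable section

open scoped Classical

namespace Summit.ValiantsHypothesis.ValiantsHypothesis.Theorems.CFIHomMonotone

open Literature.ModelTheory.FiniteModelTheory Literature.ModelTheory.FiniteModelTheory.ChenFlumLiu2025

variable {v : ℕ} {G : SimpleGraph (Fin v)} [DecidableRel G.Adj]
variable {A : Type*} {W : Type*} (F : SimpleGraph W)

/-- **The fibrewise difference injection for absorbing extensions.**  Hosts `X₀ ⊇`-wise related to `CFI(G,∅)` and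
`X₁ ⊆`-wise to `CFI(G,T)` on `CFIVertex G ⊕ A`, same gadget part (`X₁ ≤ X₀` there) and SHADOW-INVARIANT cross edges
(`x ~₁ a ⇒ x' ~₀ a` whenever `p x' = p x`): there is an injection `Hom(F,X₁) ↪ Hom(F,X₀)` preserving the shadow
`Sum.map p id` in `G₂ ⊕ A`. [cite: ChenFlumLiu2025, Lemma 12.5] -/
theorem exists_injective_shadowPreserving_ext (T : Set (Sym2 (Fin v))) [DecidablePred (· ∈ T)]
    (X₀ X₁ : SimpleGraph (CFIVertex G ⊕ A))
    (h₀ : ∀ x y, (cfiEven G).Adj x y → X₀.Adj (.inl x) (.inl y))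
    (h₁ : ∀ x y, X₁.Adj (.inl x) (.inl y) → (cfiGraph G T).Adj x y)
    (hA : ∀ a a', X₁.Adj (.inr a) (.inr a') → X₀.Adj (.inr a) (.inr a'))
    (hX : ∀ (x x' : CFIVertex G) (a : A), proj G x' = proj G x → X₁.Adj (.inl x) (.inr a) → X₀.Adj (.inl x') (.inr a)) :
    ∃ Φ : {g : W → CFIVertex G ⊕ A // Dvorak2010.IsHom F X₁ g} → {g : W → CFIVertex G ⊕ A // Dvorak2010.IsHom F X₀ g},
      Function.Injective Φ ∧ ∀ f w, Sum.map (proj G) id ((Φ f).1 w) = Sum.map (proj G) id (f.1 w) := by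
  classical
  -- shadow bookkeeping
  have hinl : ∀ (q : CFIVertex G ⊕ A) (x : CFIVertex G),
      Sum.map (proj G) id q = Sum.map (proj G) id (Sum.inl x : CFIVertex G ⊕ A) →
        ∃ x₁, q = .inl x₁ ∧ proj G x₁ = proj G x := by
    rintro (x₁ | a) x h
    · exact ⟨x₁, rfl, by simpa using h⟩
    · simp at h
  have hinr : ∀ (q : CFIVertex G ⊕ A) (a : A),
      Sum.map (proj G) id q = Sum.map (proj G) id (Sum.inr a : CFIVertex G ⊕ A) → q = .inr a := by
    rintro (x₁ | a') a h
    · simp at h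
    · simpa using h
  -- the difference on the sum type: CFI part by `dsub`, gadget part untouched
  let dif : CFIVertex G ⊕ A → CFIVertex G ⊕ A → CFIVertex G ⊕ A :=
    fun p q => Sum.map (fun x => dsub x (Sum.elim id (fun _ => x) q)) id p
  have dif_inl_inl : ∀ x y : CFIVertex G, dif (.inl x) (.inl y) = .inl (dsub x y) := fun _ _ => rfl
  have dif_inr : ∀ (a : A) (q : CFIVertex G ⊕ A), dif (.inr a) q = .inr a := fun _ _ => rfl
  have hσdif : ∀ p q, Sum.map (proj G) id (dif p q) = Sum.map (proj G) id p := by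
    rintro (x | a) q
    · show Sum.map (proj G) id (Sum.inl _) = _
      simp [proj_dsub]
    · rfl
  -- adjacent pairs with equal shadows have adjacent differences
  have hadj : ∀ p q p₁ q₁, X₁.Adj p q → X₁.Adj p₁ q₁ →
      Sum.map (proj G) id p₁ = Sum.map (proj G) id p → Sum.map (proj G) id q₁ = Sum.map (proj G) id q →
      X₀.Adj (dif p p₁) (dif q q₁) := by
    rintro (x | a) (y | b) p₁ q₁ hpq hpq₁ hp hq
    · obtain ⟨x₁, rfl, hx⟩ := hinl p₁ x hp
      obtain ⟨y₁, rfl, hy⟩ := hinl q₁ y hq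
      rw [dif_inl_inl, dif_inl_inl]
      exact h₀ _ _ (adj_dsub (h₁ _ _ hpq) (h₁ _ _ hpq₁) hx hy)
    · obtain ⟨x₁, rfl, hx⟩ := hinl p₁ x hp
      obtain rfl := hinr q₁ b hq
      rw [dif_inl_inl, dif_inr]
      exact hX x (dsub x x₁) b (proj_dsub _ _) hpq
    · obtain rfl := hinr p₁ a hp
      obtain ⟨y₁, rfl, hy⟩ := hinl q₁ y hq
      rw [dif_inr, dif_inl_inl]
      exact (hX y (dsub y y₁) a (proj_dsub _ _) hpq.symm).symm
    · obtain rfl := hinr p₁ a hp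
      obtain rfl := hinr q₁ b hq
      rw [dif_inr, dif_inr]
      exact hA _ _ hpq
  -- injectivity of the difference in its first argument over a common shadow
  have hinj : ∀ p p' q, Sum.map (proj G) id p = Sum.map (proj G) id q →
      Sum.map (proj G) id p' = Sum.map (proj G) id q → dif p q = dif p' q → p = p' := by
    rintro p p' (y | b) hp hp' h
    · obtain ⟨x, rfl, hx⟩ := hinl p y hp
      obtain ⟨x', rfl, hx'⟩ := hinl p' y hp'
      rw [dif_inl_inl, dif_inl_inl] at h
      rw [dsub_left_injective hx hx' (Sum.inl.inj h)]
    · obtain rfl := hinr p b hp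
      obtain rfl := hinr p' b hp'
      rfl
  -- a chosen element in the fibre of every realised shadow
  let base : (g : W → (Fin v ⊕ Dart G) ⊕ A) →
      (∃ f₁ : {g : W → CFIVertex G ⊕ A // Dvorak2010.IsHom F X₁ g}, Sum.map (proj G) id ∘ f₁.1 = g) →
      {g : W → CFIVertex G ⊕ A // Dvorak2010.IsHom F X₁ g} :=
    fun _ h => Classical.choose h
  have hbase : ∀ g (h : ∃ f₁ : {g : W → CFIVertex G ⊕ A // Dvorak2010.IsHom F X₁ g},
      Sum.map (proj G) id ∘ f₁.1 = g), Sum.map (proj G) id ∘ (base g h).1 = g :=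
    fun g h => Classical.choose_spec h
  have hex : ∀ f : {g : W → CFIVertex G ⊕ A // Dvorak2010.IsHom F X₁ g},
      ∃ f₁ : {g : W → CFIVertex G ⊕ A // Dvorak2010.IsHom F X₁ g},
        Sum.map (proj G) id ∘ f₁.1 = Sum.map (proj G) id ∘ f.1 :=
    fun f => ⟨f, rfl⟩
  refine ⟨fun f => ⟨fun w => dif (f.1 w) ((base _ (hex f)).1 w), fun a b hab =>
    hadj _ _ _ _ (f.2 hab) ((base _ (hex f)).2 hab) (congrFun (hbase _ (hex f)) a) (congrFun (hbase _ (hex f)) b)⟩,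
    ?_, ?_⟩
  · intro f f' hff'
    have hval : ∀ w, dif (f.1 w) ((base _ (hex f)).1 w) = dif (f'.1 w) ((base _ (hex f')).1 w) :=
      fun w => congrFun (congrArg Subtype.val hff') w
    have hpf : Sum.map (proj G) id ∘ f.1 = Sum.map (proj G) id ∘ f'.1 := by
      funext w
      have := congrArg (Sum.map (proj G) id) (hval w)
      rwa [hσdif, hσdif] at this
    have hbb : base _ (hex f) = base _ (hex f') := by
      have key : ∀ (g g' : W → (Fin v ⊕ Dart G) ⊕ A)
          (h : ∃ f₁ : {g : W → CFIVertex G ⊕ A // Dvorak2010.IsHom F X₁ g}, Sum.map (proj G) id ∘ f₁.1 = g)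
          (h' : ∃ f₁ : {g : W → CFIVertex G ⊕ A // Dvorak2010.IsHom F X₁ g}, Sum.map (proj G) id ∘ f₁.1 = g'),
          g = g' → base g h = base g' h' := by
        intro g g' h h' hgg'
        subst hgg'
        rfl
      exact key _ _ _ _ hpf
    apply Subtype.ext
    funext w
    have h1 := hval w
    rw [hbb] at h1
    refine hinj _ _ _ ?_ ?_ h1
    · have := congrFun (hbase _ (hex f')) w
      simp only [Function.comp_apply] at this
      rw [this]
      exact congrFun hpf w
    · have := congrFun (hbase _ (hex f')) w
      simp only [Function.comp_apply] at this
      rw [this]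
  · intro f w
    exact hσdif _ _

/-- **MONOTONICITY FOR ABSORBING EXTENSIONS.**  Under the hypotheses of `exists_injective_shadowPreserving_ext`:
`hom(F, X₁) ≤ hom(F, X₀)` for every finite graph `F`. [cite: Roberson2022, Thm 3.6; ChenFlumLiu2025, Lemma 12.5] -/
theorem card_hom_ext_le [Finite W] [Finite A] (T : Set (Sym2 (Fin v))) [DecidablePred (· ∈ T)]
    (X₀ X₁ : SimpleGraph (CFIVertex G ⊕ A))
    (h₀ : ∀ x y, (cfiEven G).Adj x y → X₀.Adj (.inl x) (.inl y))
    (h₁ : ∀ x y, X₁.Adj (.inl x) (.inl y) → (cfiGraph G T).Adj x y)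
    (hA : ∀ a a', X₁.Adj (.inr a) (.inr a') → X₀.Adj (.inr a) (.inr a'))
    (hX : ∀ (x x' : CFIVertex G) (a : A), proj G x' = proj G x → X₁.Adj (.inl x) (.inr a) → X₀.Adj (.inl x') (.inr a)) :
    Nat.card (F →g X₁) ≤ Nat.card (F →g X₀) := by
  classical
  rw [Dvorak2010.card_hom_eq_card_subtype, Dvorak2010.card_hom_eq_card_subtype]
  haveI := Fintype.ofFinite {g : W → CFIVertex G ⊕ A // Dvorak2010.IsHom F X₁ g}
  haveI := Fintype.ofFinite {g : W → CFIVertex G ⊕ A // Dvorak2010.IsHom F X₀ g}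
  rw [Nat.card_eq_fintype_card, Nat.card_eq_fintype_card]
  obtain ⟨Φ, hΦ, -⟩ := exists_injective_shadowPreserving_ext F T X₀ X₁ h₀ h₁ hA hX
  exact Fintype.card_le_of_injective Φ hΦ

/-- **STRICTNESS FOR ABSORBING EXTENSIONS.**  In the situation of `card_hom_ext_le` with `T = {e}`, `e` an edge of `G`,
suppose `F` retracts THROUGH the extension: there are a base graph `B` on `V(G₂) ⊕ A` and homomorphisms `ι : G₂ → F`,
`ρ : F → B` with `ρ ∘ ι = inl`, such that the zero section `zeroLift ⊕ id : B → X₀` is a homomorphism (hypotheses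
`hB`, `hBA`, `hBX`: the CFI part of `B` lies in `G₂`, its gadget and cross edges are realised in `X₀` at the zero
section).  Then `hom(F, X₁) < hom(F, X₀)`. [cite: ChenFlumLiu2025, Thm 12.2 and Example 12.4] -/
theorem card_hom_ext_lt_of_retract [Finite W] [Finite A] {e : Sym2 (Fin v)}
    [DecidablePred (· ∈ ({e} : Set (Sym2 (Fin v))))] (he : e ∈ G.edgeSet)
    (X₀ X₁ : SimpleGraph (CFIVertex G ⊕ A))
    (h₀ : ∀ x y, (cfiEven G).Adj x y → X₀.Adj (.inl x) (.inl y))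
    (h₁ : ∀ x y, X₁.Adj (.inl x) (.inl y) → (cfiGraph G ({e} : Set (Sym2 (Fin v)))).Adj x y)
    (hA : ∀ a a', X₁.Adj (.inr a) (.inr a') → X₀.Adj (.inr a) (.inr a'))
    (hX : ∀ (x x' : CFIVertex G) (a : A), proj G x' = proj G x → X₁.Adj (.inl x) (.inr a) → X₀.Adj (.inl x') (.inr a))
    (B : SimpleGraph ((Fin v ⊕ Dart G) ⊕ A))
    (hB : ∀ x y, B.Adj (.inl x) (.inl y) → (subdiv G).Adj x y)
    (hBA : ∀ a a', B.Adj (.inr a) (.inr a') → X₀.Adj (.inr a) (.inr a'))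
    (hBX : ∀ x a, B.Adj (.inl x) (.inr a) → X₀.Adj (.inl (zeroLift x)) (.inr a))
    (ι : subdiv G →g F) (ρ : F →g B) (hρι : ∀ x, ρ (ι x) = .inl x) :
    Nat.card (F →g X₁) < Nat.card (F →g X₀) := by
  classical
  rw [Dvorak2010.card_hom_eq_card_subtype, Dvorak2010.card_hom_eq_card_subtype]
  haveI := Fintype.ofFinite {g : W → CFIVertex G ⊕ A // Dvorak2010.IsHom F X₁ g}
  haveI := Fintype.ofFinite {g : W → CFIVertex G ⊕ A // Dvorak2010.IsHom F X₀ g}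
  rw [Nat.card_eq_fintype_card, Nat.card_eq_fintype_card]
  obtain ⟨Φ, hΦ, hproj⟩ := exists_injective_shadowPreserving_ext F ({e} : Set (Sym2 (Fin v))) X₀ X₁ h₀ h₁ hA hX
  refine Fintype.card_lt_of_injective_not_surjective Φ hΦ fun hsurj => ?_
  -- the zero section `zeroLift ⊕ id` over `ρ` is a homomorphism `F → X₀`
  have hsec : Dvorak2010.IsHom B X₀ (Sum.map zeroLift id) := by
    rintro (x | a) (y | b) h
    · exact h₀ _ _ (isHom_zeroLift (hB _ _ h))
    · exact hBX _ _ h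
    · exact (hBX _ _ h.symm).symm
    · exact hBA _ _ h
  have hzero : Dvorak2010.IsHom F X₀ (fun w => Sum.map zeroLift id (ρ w)) :=
    fun a b hab => hsec (ρ.map_rel hab)
  obtain ⟨f, hf⟩ := hsurj ⟨_, hzero⟩
  -- along `ι`, `f` lies over the identity of `G₂` inside the CFI part
  have hshape : ∀ x, ∃ y, f.1 (ι x) = .inl y ∧ proj G y = x := by
    intro x
    have h1 := hproj f (ι x)
    have h2 : (Φ f).1 (ι x) = Sum.map zeroLift id (ρ (ι x)) := congrFun (congrArg Subtype.val hf) (ι x)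
    rw [h2, hρι] at h1
    rcases hfx : f.1 (ι x) with y | a
    · rw [hfx] at h1
      refine ⟨y, rfl, ?_⟩
      have := Sum.inl.inj h1
      simpa using this.symm
    · rw [hfx] at h1
      simp at h1
  choose g hg hpg using hshape
  refine not_isHom_of_proj_eq he (f := g) (fun a b hab => ?_) hpg
  have h := f.2 (ι.map_rel hab)
  rw [hg a, hg b] at h
  exact h₁ _ _ h

end Summit.ValiantsHypothesis.ValiantsHypothesis.Theorems.CFIHomMonotone

end
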